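import Summits.FinalStateConjecture.FinalStateConjecture.Theses.ClusterCompleteness
import Summits.FinalStateConjecture.FinalStateConjecture.Theorems.ClusterCompletenessOmegaLimitMultiKerrT2Defs
import HarnessLib

/-!
# Route ClusterCompleteness · crux `OmegaLimitMultiKerr` — the BIRTH-line vocabulary
# (`RecursO`, `TameRecursO`; posited objects, D-0016 `<Route>Defs` convention)

Vocabulary of the registered line `Lines/birth.lean` of the crux
`ClusterCompleteness.OmegaLimitMultiKerr` (stmt-FinalStateConjecture-17639, rank 9, rev 21 / Statement
re-type T2), filed by its line lead so that the line's helper theorems (the stubs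
`stub_orderUpgradeAssembly`, and eventually the sorry-free skeleton) can be landed under `Theorems/`
with statements that read VERBATIM as registered:

* `RecursO k 𝒟` — **recurs at order `k`, anchored and oriented**: VERBATIM the conclusion of the crux
  at order `k` (= the hypothesis of the route's target `RecurrentMultiKerrCapture`, rev 21): the 13
  clauses C1–C13 (sub-extremal labels and motions, late hole charts on boosted Kerr exteriors and a late
  flat chart into `O = exteriorOf charted`, sublinear tubes, honest radii, tube complement inside the
  flat domain, separation at every radius, `O = exteriorOf …`, `RaysStayInClosure`, exhaustion at every
  chart time, orthochronous motions / future-directed flat chart time, the uniform `C⁰` anchor `1/4`,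
  and `Cᵏ` `ε`-recurrence at every radius with future-directed transported Kerr time vectors);
* `TameRecursO k 𝒟` — **tame, thick-window coarse recurrence**: the same chart data and clauses
  C1–C12 verbatim, then (T1) an eventual all-time `C^{k+1}` bound of the flat deviation, (T2) for
  every radius an eventual all-time `C^{k+1}` bound of every hole's truncated deviation, (T3) a
  uniform interior-ball condition on the late flat domain, (T4) for every radius and `ε > 0`,
  frequently in chart time `τ`, `C⁰` deviations `≤ ε` on EVERY slab of the window `[τ − 1, τ + 1]`
  and future-directed transported Kerr time vectors at the centre slab — the matrix of the line's
  generic stub `stub_genericSettlesOrTameRecurs` and the hypothesis of its pointwise order upgrade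
  `TameRecursO k 𝒟 → RecursO k 𝒟`;
* `omegaLimitMultiKerr_iff` — read-back certificate (`Iff.rfl`): the crux IS "for every `k` and `X`,
  tame-generically, an MGHD exists and every MGHD not settling in the T2 sense (`SettlesT2`) satisfies
  `RecursO k`".

Everything is a definition over EXISTING declarations (the Lorentz prelude `IsLateChart`,
`deviationCk`, `truncDeviationCk`, `boostedKerrBackground`, `Minkowski.backgroundOn`, the Statement's
`exteriorOf`, `RaysStayInClosure`, `IsOrthochronous`, and `SettlesT2` of `…OmegaLimitMultiKerrT2Defs`)
or `Iff.rfl`; no new mathematics. References: Dafermos–Luk arXiv:1710.01722, §1.2.1 and Conjecture 1;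
Christodoulou, CQG 16 (1999) A23; the sup-norm interpolation behind the order upgrade is
Gagliardo 1959 / Nirenberg 1959 (not used in this file).
-/

-- every `Summit.FinalStateConjecture.FinalStateConjecture.…` name repeats the summit = sub-problem segment (D-0017 layout)
set_option linter.dupNamespace false

noncomputable section

open scoped Manifold ContDiff Topology ENNReal
open Set Filter Function TopologicalSpace

namespace Summit.FinalStateConjecture.FinalStateConjecture.Theorems.ClusterCompleteness

open Literature.Geometry.Lorentzian
open Summit.FinalStateConjecture.FinalStateConjecture.Theses.ClusterCompleteness (OmegaLimitMultiKerr)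

section PerDevelopment

variable {X : Type} [TopologicalSpace X] [ChartedSpace E3 X] [IsManifold (𝓡 3) ∞ X]
  [ConnectedSpace X] {D : InitialDataSet (𝓡 3) X}

/-- **Recurs at order `k`, anchored and oriented** (one development `𝒟`): VERBATIM the conclusion
of `ClusterCompleteness.OmegaLimitMultiKerr` (stmt-FinalStateConjecture-17639) at order `k` = the
hypothesis of `ClusterCompleteness.RecurrentMultiKerrCapture` (rev 21): `N ≥ 0` sub-extremal labels
and motions, hole charts `Ψᵢ` on the boosted Kerr exteriors and a flat chart `Ψ₀`, all late charts
into `O = exteriorOf charted` (C1–C3, C8), sublinear tubes inside the flat domain (C4, C6), honest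
radii (C5), separation at every radius (C7), rays stay in `closure O` (C9), exhaustion at every
chart time (C10), orthochronous motions and future-directed flat chart time (C11), the uniform `C⁰`
anchor `1/4` (C12), and `Cᵏ` `ε`-recurrence at every radius with future-directed transported Kerr
time vectors at the recurrence times (C13). [cite: DafermosLuk2017, §1.2.1] -/
def RecursO (k : ℕ) (𝒟 : VacuumCauchyDevelopment D) : Prop :=
  ∃ (O : Set 𝒟.carrier) (N : ℕ) (M a : Fin N → ℝ) (mo : Fin N → lorentzGroup × E4) (τ₀ : ℝ) (Ψ : ∀
    i, boostedKerrExterior (mo i).1 (mo i).2 (M i) (a i) → 𝒟.carrier) (ρ R : Fin N → ℝ → ℝ) (U₀ :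
    Opens E4) (Ψ₀ : U₀ → 𝒟.carrier), (∀ i, Kerr.IsSubextremal (M i) (a i)) ∧ (∀ i,
    𝒟.toSpacetime.IsLateChart (boostedKerrBackground (mo i).1 (mo i).2 (M i) (a i)) O τ₀ (Ψ i)) ∧
    𝒟.toSpacetime.IsLateChart (Minkowski.backgroundOn U₀) O τ₀ Ψ₀ ∧ (∀ i, Tendsto (fun t ↦ ρ i t /
    t) atTop (𝓝 0)) ∧ (∀ i, Tendsto (R i) atTop atTop ∧ ∀ τ, max (Kerr.rPlus (M i) (a i)) 0 + 1 ≤ R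
    i τ) ∧ {x : E4 | τ₀ < x 0 ∧ ∀ i, ρ i (x 0) < Kerr.radius (a i) (poincareInv (mo i).1 (mo i).2
    x)} ⊆ (U₀ : Set E4) ∧ (∀ R' : ℝ, ∃ τ₁ : ℝ, Pairwise (Function.onFun Disjoint fun i ↦ Ψ i ''
    (boostedKerrBackground (mo i).1 (mo i).2 (M i) (a i)).truncLateRegion τ₁ R')) ∧ O =
    Summit.FinalStateConjecture.exteriorOf 𝒟.toCauchyDevelopment ((⋃ i, Ψ i ''
    (boostedKerrBackground (mo i).1 (mo i).2 (M i) (a i)).lateRegion τ₀) ∪ Ψ₀ ''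
    (Minkowski.backgroundOn U₀).lateRegion τ₀) ∧ Summit.FinalStateConjecture.RaysStayInClosure
    𝒟.toCauchyDevelopment O ∧ (∀ τ₁ : ℝ, τ₀ < τ₁ → O \ (Ψ₀ '' (Minkowski.backgroundOn U₀).lateRegion
    τ₁ ∪ ⋃ i, Ψ i '' {x | τ₁ < (boostedKerrBackground (mo i).1 (mo i).2 (M i) (a i)).time x.1 ∧
    (boostedKerrBackground (mo i).1 (mo i).2 (M i) (a i)).radius x.1 ≤ R i ((boostedKerrBackground
    (mo i).1 (mo i).2 (M i) (a i)).time x.1)}) ⊆ 𝒟.metric.causalPast 𝒟.timeOrientation (Ψ₀ ''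
    (Minkowski.backgroundOn U₀).timeSlab τ₁ ∪ ⋃ i, Ψ i '' (boostedKerrBackground (mo i).1 (mo i).2
    (M i) (a i)).truncTimeSlab (R i τ₁) τ₁)) ∧ ((∀ i, Summit.FinalStateConjecture.IsOrthochronous
    (mo i).1) ∧ ∀ τ : ℝ, τ₀ < τ → ∀ x ∈ (Minkowski.backgroundOn U₀).timeSlab τ,
    𝒟.toSpacetime.timeOrientation.IsFutureDirected (mfderiv 𝓘(ℝ, E4) (𝓡 4) Ψ₀ x (E4.basisVector 0)))
    ∧ (∀ τ : ℝ, τ₀ < τ → 𝒟.toSpacetime.deviationCk (Minkowski.backgroundOn U₀) Ψ₀ 0 τ ≤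
    ENNReal.ofReal (1 / 4) ∧ ∀ i, 𝒟.toSpacetime.truncDeviationCk (boostedKerrBackground (mo i).1 (mo
    i).2 (M i) (a i)) (Ψ i) 0 (R i τ) τ ≤ ENNReal.ofReal (1 / 4)) ∧ ∀ R' : ℝ, ∀ ε : ℝ, 0 < ε → ∃ᶠ τ
    in atTop, 𝒟.toSpacetime.deviationCk (Minkowski.backgroundOn U₀) Ψ₀ k τ ≤ ENNReal.ofReal ε ∧ ∀ i,
    𝒟.toSpacetime.truncDeviationCk (boostedKerrBackground (mo i).1 (mo i).2 (M i) (a i)) (Ψ i) k R'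
    τ ≤ ENNReal.ofReal ε ∧ ∀ x ∈ (boostedKerrBackground (mo i).1 (mo i).2 (M i) (a i)).truncTimeSlab
    R' τ, 𝒟.toSpacetime.timeOrientation.IsFutureDirected (mfderiv 𝓘(ℝ, E4) (𝓡 4) (Ψ i) x (((mo i).1
    : E4 ≃L[ℝ] E4) (Kerr.timeVector (M i) (a i) (poincareInv (mo i).1 (mo i).2 (x : E4)))))

/-- **Tame, thick-window coarse recurrence at order `k`** (one development `𝒟`): the same chart
data and clauses C1–C12 VERBATIM, then (T1) eventual all-time `C^{k+1}` bound of the flat deviation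
on the flat slabs, (T2) for every radius an eventual all-time `C^{k+1}` bound of every hole's
truncated deviation, (T3) a uniform interior-ball condition on the late part of the flat domain
`U₀`, and (T4) COARSE recurrence: for every radius `R'` and `ε > 0`, frequently in chart time `τ`,
the `C⁰` deviations (flat, and every hole's truncated one out to `R'`) are `≤ ε` on EVERY slab of
the window `s ∈ [τ − 1, τ + 1]`, and at the centre slab the transported Kerr time vectors are
pushed forward future-directed (the orientation half of C13, unchanged). [cite: DafermosLuk2017, §1.2.1] -/
def TameRecursO (k : ℕ) (𝒟 : VacuumCauchyDevelopment D) : Prop :=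
  ∃ (O : Set 𝒟.carrier) (N : ℕ) (M a : Fin N → ℝ) (mo : Fin N → lorentzGroup × E4) (τ₀ : ℝ) (Ψ : ∀
    i, boostedKerrExterior (mo i).1 (mo i).2 (M i) (a i) → 𝒟.carrier) (ρ R : Fin N → ℝ → ℝ) (U₀ :
    Opens E4) (Ψ₀ : U₀ → 𝒟.carrier), (∀ i, Kerr.IsSubextremal (M i) (a i)) ∧ (∀ i,
    𝒟.toSpacetime.IsLateChart (boostedKerrBackground (mo i).1 (mo i).2 (M i) (a i)) O τ₀ (Ψ i)) ∧
    𝒟.toSpacetime.IsLateChart (Minkowski.backgroundOn U₀) O τ₀ Ψ₀ ∧ (∀ i, Tendsto (fun t ↦ ρ i t /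
    t) atTop (𝓝 0)) ∧ (∀ i, Tendsto (R i) atTop atTop ∧ ∀ τ, max (Kerr.rPlus (M i) (a i)) 0 + 1 ≤ R
    i τ) ∧ {x : E4 | τ₀ < x 0 ∧ ∀ i, ρ i (x 0) < Kerr.radius (a i) (poincareInv (mo i).1 (mo i).2
    x)} ⊆ (U₀ : Set E4) ∧ (∀ R' : ℝ, ∃ τ₁ : ℝ, Pairwise (Function.onFun Disjoint fun i ↦ Ψ i ''
    (boostedKerrBackground (mo i).1 (mo i).2 (M i) (a i)).truncLateRegion τ₁ R')) ∧ O =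
    Summit.FinalStateConjecture.exteriorOf 𝒟.toCauchyDevelopment ((⋃ i, Ψ i ''
    (boostedKerrBackground (mo i).1 (mo i).2 (M i) (a i)).lateRegion τ₀) ∪ Ψ₀ ''
    (Minkowski.backgroundOn U₀).lateRegion τ₀) ∧ Summit.FinalStateConjecture.RaysStayInClosure
    𝒟.toCauchyDevelopment O ∧ (∀ τ₁ : ℝ, τ₀ < τ₁ → O \ (Ψ₀ '' (Minkowski.backgroundOn U₀).lateRegion
    τ₁ ∪ ⋃ i, Ψ i '' {x | τ₁ < (boostedKerrBackground (mo i).1 (mo i).2 (M i) (a i)).time x.1 ∧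
    (boostedKerrBackground (mo i).1 (mo i).2 (M i) (a i)).radius x.1 ≤ R i ((boostedKerrBackground
    (mo i).1 (mo i).2 (M i) (a i)).time x.1)}) ⊆ 𝒟.metric.causalPast 𝒟.timeOrientation (Ψ₀ ''
    (Minkowski.backgroundOn U₀).timeSlab τ₁ ∪ ⋃ i, Ψ i '' (boostedKerrBackground (mo i).1 (mo i).2
    (M i) (a i)).truncTimeSlab (R i τ₁) τ₁)) ∧ ((∀ i, Summit.FinalStateConjecture.IsOrthochronous
    (mo i).1) ∧ ∀ τ : ℝ, τ₀ < τ → ∀ x ∈ (Minkowski.backgroundOn U₀).timeSlab τ,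
    𝒟.toSpacetime.timeOrientation.IsFutureDirected (mfderiv 𝓘(ℝ, E4) (𝓡 4) Ψ₀ x (E4.basisVector 0)))
    ∧ (∀ τ : ℝ, τ₀ < τ → 𝒟.toSpacetime.deviationCk (Minkowski.backgroundOn U₀) Ψ₀ 0 τ ≤
    ENNReal.ofReal (1 / 4) ∧ ∀ i, 𝒟.toSpacetime.truncDeviationCk (boostedKerrBackground (mo i).1 (mo
    i).2 (M i) (a i)) (Ψ i) 0 (R i τ) τ ≤ ENNReal.ofReal (1 / 4)) ∧ (∃ B : NNReal, ∃ τT : ℝ, ∀ τ :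
    ℝ, τT ≤ τ → 𝒟.toSpacetime.deviationCk (Minkowski.backgroundOn U₀) Ψ₀ (k + 1) τ ≤ (B : ENNReal))
    ∧ (∀ R' : ℝ, ∃ B : NNReal, ∃ τT : ℝ, ∀ τ : ℝ, τT ≤ τ → ∀ i, 𝒟.toSpacetime.truncDeviationCk
    (boostedKerrBackground (mo i).1 (mo i).2 (M i) (a i)) (Ψ i) (k + 1) R' τ ≤ (B : ENNReal)) ∧ (∃
    r₀ : ℝ, 0 < r₀ ∧ ∃ τT : ℝ, ∀ x ∈ (U₀ : Set E4), τT ≤ x 0 → ∃ y : E4, x ∈ Metric.ball y r₀ ∧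
    Metric.ball y r₀ ⊆ (U₀ : Set E4)) ∧ ∀ R' : ℝ, ∀ ε : ℝ, 0 < ε → ∃ᶠ τ in atTop, (∀ s ∈ Set.Icc (τ
    - 1) (τ + 1), 𝒟.toSpacetime.deviationCk (Minkowski.backgroundOn U₀) Ψ₀ 0 s ≤ ENNReal.ofReal ε ∧
    ∀ i, 𝒟.toSpacetime.truncDeviationCk (boostedKerrBackground (mo i).1 (mo i).2 (M i) (a i)) (Ψ i)
    0 R' s ≤ ENNReal.ofReal ε) ∧ ∀ i, ∀ x ∈ (boostedKerrBackground (mo i).1 (mo i).2 (M i) (a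
    i)).truncTimeSlab R' τ, 𝒟.toSpacetime.timeOrientation.IsFutureDirected (mfderiv 𝓘(ℝ, E4) (𝓡 4)
    (Ψ i) x (((mo i).1 : E4 ≃L[ℝ] E4) (Kerr.timeVector (M i) (a i) (poincareInv (mo i).1 (mo i).2 (x
    : E4)))))

end PerDevelopment

/-- **Read-back (certificate that the vocabulary is verbatim):** the crux IS "for every `k` and
`X`, tame-generically, an MGHD exists and every MGHD not settling in the T2 sense recurs at order
`k` in the oriented interface". `Iff.rfl`. [folklore] -/
theorem omegaLimitMultiKerr_iff :
    OmegaLimitMultiKerr ↔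
      ∀ (k : ℕ) (X : Type) [TopologicalSpace X] [ChartedSpace E3 X] [IsManifold (𝓡 3) ∞ X]
        [T2Space X] [SecondCountableTopology X] [ConnectedSpace X],
        InitialDataSet.IsTameChristodoulouGeneric (admissibleVacuumData X)
          (fun D ↦ (∃ 𝒟 : VacuumCauchyDevelopment D, 𝒟.IsMaximal) ∧
            ∀ 𝒟 : VacuumCauchyDevelopment D, 𝒟.IsMaximal → ¬ SettlesT2 𝒟 → RecursO k 𝒟) 1 :=
  Iff.rfl

end Summit.FinalStateConjecture.FinalStateConjecture.Theorems.ClusterCompleteness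

end
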